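import Summits.ValiantsHypothesis.ValiantsHypothesis.Theorems.DefinabilityGapThreeMatchings
import HarnessLib

/-!
# DefinabilityGap — MATCHING CLUSTERS: the gap scale, near-classes, the common core, disjoint kill edges

Route `route-ValiantsHypothesis-DefinabilityGap` (decomp-valiant, lens 5: hardness–randomness / PIT axis); width
road of the read-once leaf F4 / W10 (`KIPlantedHittingRO`, stmt-ValiantsHypothesis-23704, aside). Pure finite-set
combinatorics — no polynomial, no generator: the z-side CLUSTERING of a family of ≤ k product gates (edge sets `M`)
that `DefinabilityGapMatchingSums` feeds into the merge lever of `DefinabilityGapClusterMerging`.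
ELEMENTARY · INSTRUMENT (z-side: GAP-SCALE clustering of product gates + one vertex-disjoint kill edge per foreign
gate — the NEW part of the cluster-isolation argument, here as bare counting lemmas) · 0 S-currency · closes NO
item · K1 / stmt-23704 / VP ≠ VNP untouched.

## The gap scale (§1, `exists_gap_level`)

For a family `s` of `≤ k` finite sets and a base `c ≥ 2`, the `≤ k²` distances `δ(M, M′) = |M ∖ M′|` have `≤ k²`
values of `⌊log_c δ⌋`, so one of the `k² + 1` levels `t ≤ k²` is skipped: with `R = c^t` (`1 ≤ R ≤ c^{k²}`) EVERY
pair is near (`δ < R`) or far (`δ ≥ cR`) — nothing in between.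

## Near-classes and the core (§2)

For a reflexive, symmetric, transitive relation on `s` (near-ness at a skipped scale, for sets of equal size) and
weights with nonzero total, some cluster of the relation has nonzero weight (`exists_class_sum_ne_zero`, strong
induction: peel off clusters of weight zero). Inside a family `H` of pairwise near sets the common CORE `C = {e ∈ M₀ : ∀ M ∈ H, e ∈ M}` misses
`≤ |H|·R` elements of each member (`card_sdiff_core_le`); the non-core elements and their endpoints are bounded by
`card_biUnion_sdiff_le`, `card_endpoints_le`; `card_sdiff_le_add` is the triangle inequality for `|· ∖ ·|`.

## Disjoint kill edges (§3, `exists_disjoint_selection`)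

A MATCHING (distinct edges share no endpoint) has at most `|X|` edges touching a vertex set `X`
(`card_filter_touch_le`). Hence from gates `N_i` (`i ∈ 𝓕`) that are matchings with `|N_i| > |X| + 2(|𝓕| − 1)` one
can pick, greedily, one edge per gate, all endpoints outside `X`, pairwise vertex-disjoint
(`exists_disjoint_selection`, induction on `𝓕`; the selection is returned as a SET `S` of `≤ |𝓕|` edges with
`∀ i, ∃ e ∈ S, e ∈ N_i`).

## Where this sits (HONEST BOUNDARY)

Pure instrument: no statement about polynomials or generators is made here. General graphical MULTISETS, affine
forms and the leaf regime w = q^b ≫ m are NOT claimed anywhere on this road; K1 / stmt-23704 / VP ≠ VNP untouched.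
-/

set_option linter.dupNamespace false

namespace Summit.ValiantsHypothesis.ValiantsHypothesis.Theorems.DefinabilityGapMatchingClusters

/-! ## 1. The gap scale -/

/-- ★ **GAP LEVEL**: among `≤ k` finite sets, some scale `R = c^t` (`t ≤ k²`) separates all distances `|M ∖ M′|`
into near (`< R`) and far (`≥ cR`). [this file] -/
theorem exists_gap_level {α : Type*} [DecidableEq α] (s : Finset (Finset α)) {k c : ℕ} (hk : s.card ≤ k)
    (hc : 2 ≤ c) : ∃ R : ℕ, 1 ≤ R ∧ R ≤ c ^ (k ^ 2) ∧
      ∀ M ∈ s, ∀ M' ∈ s, (M \ M').card < R ∨ c * R ≤ (M \ M').card := by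
  have hU : ((s ×ˢ s).image fun MM : Finset α × Finset α => Nat.log c (MM.1 \ MM.2).card).card <
      (Finset.range (k ^ 2 + 1)).card := by
    rw [Finset.card_range]
    calc ((s ×ˢ s).image fun MM : Finset α × Finset α => Nat.log c (MM.1 \ MM.2).card).card
        ≤ (s ×ˢ s).card := Finset.card_image_le
      _ = s.card * s.card := Finset.card_product s s
      _ ≤ k * k := Nat.mul_le_mul hk hk
      _ < k ^ 2 + 1 := by rw [sq]; exact Nat.lt_succ_self _
  obtain ⟨t, ht, htU⟩ := Finset.exists_mem_notMem_of_card_lt_card hU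
  rw [Finset.mem_range] at ht
  refine ⟨c ^ t, Nat.one_le_pow _ _ (by omega), Nat.pow_le_pow_right (by omega) (by omega),
    fun M hM M' hM' => ?_⟩
  by_contra hMM
  rw [not_or, not_lt, not_le] at hMM
  apply htU
  rw [Finset.mem_image]
  refine ⟨(M, M'), Finset.mk_mem_product hM hM', ?_⟩
  have h2 : (M \ M').card < c ^ (t + 1) := by rw [pow_succ']; exact hMM.2
  exact Nat.log_eq_of_pow_le_of_lt_pow hMM.1 h2

/-! ## 2. Near-classes and the core -/

/-- Some cluster of an equivalence-like relation carries nonzero weight when the total weight is nonzero. [this file] -/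
theorem exists_class_sum_ne_zero {ι N : Type*} [AddCommMonoid N] (s : Finset ι) (r : ι → ι → Prop)
    [DecidableRel r] (hrefl : ∀ a ∈ s, r a a) (hsymm : ∀ a ∈ s, ∀ b ∈ s, r a b → r b a)
    (htrans : ∀ a ∈ s, ∀ b ∈ s, ∀ c ∈ s, r a b → r b c → r a c) (w : ι → N)
    (hw : ∑ a ∈ s, w a ≠ 0) : ∃ a ∈ s, ∑ b ∈ s with r a b, w b ≠ 0 := by
  classical
  suffices key : ∀ t : Finset ι, t ⊆ s → (∀ a ∈ t, ∀ b ∈ s, r a b → b ∈ t) → ∑ a ∈ t, w a ≠ 0 →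
      ∃ a ∈ t, ∑ b ∈ s with r a b, w b ≠ 0 by
    obtain ⟨a, ha, h⟩ := key s (Finset.Subset.refl s) (fun a _ b hb _ => hb) hw
    exact ⟨a, ha, h⟩
  intro t
  induction t using Finset.strongInduction with
  | H t ih =>
    intro hts hcl hsum
    obtain ⟨a, hat⟩ := Finset.nonempty_of_sum_ne_zero hsum
    by_cases hH : ∑ b ∈ s with r a b, w b = 0
    · have hHt : (s.filter fun b => r a b) ⊆ t := fun b hb =>
        hcl a hat b (Finset.mem_filter.1 hb).1 (Finset.mem_filter.1 hb).2
      have hsum' : ∑ b ∈ t \ s.filter (fun b => r a b), w b ≠ 0 := by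
        intro h0
        apply hsum
        rw [← Finset.sum_sdiff hHt, h0, hH, zero_add]
      have hlt : t \ s.filter (fun b => r a b) ⊂ t :=
        Finset.sdiff_ssubset hHt ⟨a, Finset.mem_filter.2 ⟨hts hat, hrefl a (hts hat)⟩⟩
      obtain ⟨a', ha', h'⟩ := ih _ hlt (fun b hb => hts (Finset.sdiff_subset hb)) (fun b' hb' b hb hr => by
        rw [Finset.mem_sdiff] at hb' ⊢
        refine ⟨hcl b' hb'.1 b hb hr, fun hbH => hb'.2 ?_⟩
        rw [Finset.mem_filter] at hbH ⊢
        exact ⟨hts hb'.1, htrans a (hts hat) b hb b' (hts hb'.1) hbH.2 (hsymm b' (hts hb'.1) b hb hr)⟩) hsum'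
      exact ⟨a', Finset.sdiff_subset ha', h'⟩
    · exact ⟨a, hat, hH⟩

/-- Triangle inequality for `|· ∖ ·|`. [this file] -/
theorem card_sdiff_le_add {α : Type*} [DecidableEq α] (s t u : Finset α) :
    (s \ u).card ≤ (s \ t).card + (t \ u).card := by
  refine (Finset.card_le_card fun x hx => ?_).trans (Finset.card_union_le _ _)
  rw [Finset.mem_sdiff] at hx
  rw [Finset.mem_union, Finset.mem_sdiff, Finset.mem_sdiff]
  by_cases hxt : x ∈ t
  · exact Or.inr ⟨hxt, hx.2⟩
  · exact Or.inl ⟨hx.1, hxt⟩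

/-- The common CORE of a family of pairwise near sets misses `≤ |H|·R` elements of each member. [this file] -/
theorem card_sdiff_core_le {α : Type*} [DecidableEq α] (H : Finset (Finset α)) {M₀ : Finset α} (hM₀ : M₀ ∈ H)
    {R : ℕ} (hnear : ∀ M ∈ H, ∀ M' ∈ H, (M \ M').card ≤ R) {M : Finset α} (hM : M ∈ H) :
    (M \ M₀.filter fun e => ∀ M' ∈ H, e ∈ M').card ≤ H.card * R := by
  calc (M \ M₀.filter fun e => ∀ M' ∈ H, e ∈ M').card ≤ (H.biUnion fun M' => M \ M').card := by
        refine Finset.card_le_card fun e he => ?_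
        rw [Finset.mem_sdiff, Finset.mem_filter] at he
        obtain ⟨heM, hne⟩ := he
        rw [Finset.mem_biUnion]
        by_cases he₀ : e ∈ M₀
        · have h' : ∃ M' ∈ H, e ∉ M' := by
            by_contra hcon
            exact hne ⟨he₀, fun M' hM' => Classical.byContradiction fun heM' => hcon ⟨M', hM', heM'⟩⟩
          obtain ⟨M', hM', heM'⟩ := h'
          exact ⟨M', hM', Finset.mem_sdiff.2 ⟨heM, heM'⟩⟩
        · exact ⟨M₀, hM₀, Finset.mem_sdiff.2 ⟨heM, he₀⟩⟩
    _ ≤ ∑ M' ∈ H, (M \ M').card := Finset.card_biUnion_le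
    _ ≤ ∑ M' ∈ H, R := Finset.sum_le_sum fun M' hM' => hnear M hM M' hM'
    _ = H.card * R := by rw [Finset.sum_const, smul_eq_mul]

/-- The non-core elements of a family are few. [this file] -/
theorem card_biUnion_sdiff_le {α : Type*} [DecidableEq α] (H : Finset (Finset α)) (C : Finset α) {B : ℕ}
    (h : ∀ M ∈ H, (M \ C).card ≤ B) : (H.biUnion fun M => M \ C).card ≤ H.card * B := by
  exact Finset.card_biUnion_le.trans ((Finset.sum_le_sum h).trans (by rw [Finset.sum_const, smul_eq_mul]))

/-- An edge set has at most twice as many endpoints as edges. [this file] -/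
theorem card_endpoints_le {α : Type*} [DecidableEq α] (F : Finset (α × α)) :
    (F.biUnion fun e => ({e.1, e.2} : Finset α)).card ≤ 2 * F.card := by
  exact Finset.card_biUnion_le.trans ((Finset.sum_le_sum fun e _ => Finset.card_le_two).trans
    (by rw [Finset.sum_const, smul_eq_mul, mul_comm]))

/-! ## 3. Disjoint kill edges -/

/-- A matching has at most `|X|` edges touching `X`. [this file] -/
theorem card_filter_touch_le {α : Type*} [DecidableEq α] {N : Finset (α × α)}
    (hd : ∀ e ∈ N, ∀ e' ∈ N, e ≠ e' → e.1 ≠ e'.1 ∧ e.1 ≠ e'.2 ∧ e.2 ≠ e'.1 ∧ e.2 ≠ e'.2) (X : Finset α) :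
    (N.filter fun e => e.1 ∈ X ∨ e.2 ∈ X).card ≤ X.card := by
  refine Finset.card_le_card_of_injOn (fun e => if e.1 ∈ X then e.1 else e.2) (fun e he => ?_)
    fun e he e' he' h => ?_
  · have he₂ := (Finset.mem_filter.1 (Finset.mem_coe.1 he)).2
    show (if e.1 ∈ X then e.1 else e.2) ∈ (X : Set α)
    rw [Finset.mem_coe]
    by_cases h1 : e.1 ∈ X
    · rw [if_pos h1]; exact h1
    · rw [if_neg h1]; exact he₂.resolve_left h1
  · have heN := (Finset.mem_filter.1 (Finset.mem_coe.1 he)).1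
    have heN' := (Finset.mem_filter.1 (Finset.mem_coe.1 he')).1
    have h' : (if e.1 ∈ X then e.1 else e.2) = (if e'.1 ∈ X then e'.1 else e'.2) := h
    by_contra hne
    have h4 := hd e heN e' heN' hne
    by_cases h1 : e.1 ∈ X
    · by_cases h2 : e'.1 ∈ X
      · rw [if_pos h1, if_pos h2] at h'; exact h4.1 h'
      · rw [if_pos h1, if_neg h2] at h'; exact h4.2.1 h'
    · by_cases h2 : e'.1 ∈ X
      · rw [if_neg h1, if_pos h2] at h'; exact h4.2.2.1 h'
      · rw [if_neg h1, if_neg h2] at h'; exact h4.2.2.2 h'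

/-- ★ **GREEDY DISJOINT SELECTION**: from matchings `N_i` (`i ∈ 𝓕`) with `|N_i| > |X| + 2(|𝓕| − 1)` pick one
edge per gate, endpoints outside `X`, pairwise vertex-disjoint — returned as a set `S` of `≤ |𝓕|` edges.
[this file] -/
theorem exists_disjoint_selection {α ι : Type*} [DecidableEq α] (𝓕 : Finset ι) (N : ι → Finset (α × α))
    (hd : ∀ i ∈ 𝓕, ∀ e ∈ N i, ∀ e' ∈ N i, e ≠ e' → e.1 ≠ e'.1 ∧ e.1 ≠ e'.2 ∧ e.2 ≠ e'.1 ∧ e.2 ≠ e'.2)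
    (X : Finset α) (hbig : ∀ i ∈ 𝓕, X.card + 2 * 𝓕.card < (N i).card + 2) :
    ∃ S : Finset (α × α), S.card ≤ 𝓕.card ∧ (∀ e ∈ S, ∃ i ∈ 𝓕, e ∈ N i) ∧ (∀ i ∈ 𝓕, ∃ e ∈ S, e ∈ N i) ∧
      (∀ e ∈ S, e.1 ∉ X ∧ e.2 ∉ X) ∧
      ∀ e ∈ S, ∀ e' ∈ S, e ≠ e' → e.1 ≠ e'.1 ∧ e.1 ≠ e'.2 ∧ e.2 ≠ e'.1 ∧ e.2 ≠ e'.2 := by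
  classical
  induction 𝓕 using Finset.induction_on with
  | empty =>
    exact ⟨∅, le_rfl, fun e he => absurd he (Finset.notMem_empty e), fun i hi => absurd hi (Finset.notMem_empty i),
      fun e he => absurd he (Finset.notMem_empty e), fun e he => absurd he (Finset.notMem_empty e)⟩
  | insert i 𝓕 hi ih =>
    rw [Finset.card_insert_of_notMem hi] at hbig ⊢
    obtain ⟨S, hSc, hSN, hNS, hSX, hSd⟩ := ih (fun j hj => hd j (Finset.mem_insert_of_mem hj))
      fun j hj => by have := hbig j (Finset.mem_insert_of_mem hj); omega
    -- the forbidden vertices `X ∪ V(S)` are fewer than the edges of `N i`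
    have hX' : (X ∪ S.biUnion fun e => ({e.1, e.2} : Finset α)).card < (N i).card := by
      have h1 := Finset.card_union_le X (S.biUnion fun e => ({e.1, e.2} : Finset α))
      have h2 := card_endpoints_le S
      have h3 := hbig i (Finset.mem_insert_self i 𝓕)
      omega
    obtain ⟨e, heN, heX⟩ := Finset.exists_mem_notMem_of_card_lt_card (lt_of_le_of_lt
      (card_filter_touch_le (hd i (Finset.mem_insert_self i 𝓕)) (X ∪ S.biUnion fun e => ({e.1, e.2} : Finset α)))
      hX')
    rw [Finset.mem_filter, not_and, not_or] at heX
    have hnot : ∀ {v : α}, v ∉ X ∪ S.biUnion (fun e => ({e.1, e.2} : Finset α)) →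
        v ∉ X ∧ ∀ e' ∈ S, v ≠ e'.1 ∧ v ≠ e'.2 := fun {v} hv => by
      rw [Finset.mem_union, not_or, Finset.mem_biUnion] at hv
      refine ⟨hv.1, fun e' he' => ⟨fun h => hv.2 ⟨e', he', ?_⟩, fun h => hv.2 ⟨e', he', ?_⟩⟩⟩
      · rw [h]; exact Finset.mem_insert_self _ _
      · rw [h]; exact Finset.mem_insert_of_mem (Finset.mem_singleton_self _)
    obtain ⟨he1X, he1S⟩ := hnot (heX heN).1
    obtain ⟨he2X, he2S⟩ := hnot (heX heN).2
    refine ⟨insert e S, (Finset.card_insert_le e S).trans (by omega), fun a ha => ?_, fun j hj => ?_,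
      fun a ha => ?_, fun a ha b hb hab => ?_⟩
    · rcases Finset.mem_insert.1 ha with rfl | haS
      · exact ⟨i, Finset.mem_insert_self i 𝓕, heN⟩
      · obtain ⟨j, hj, h⟩ := hSN a haS
        exact ⟨j, Finset.mem_insert_of_mem hj, h⟩
    · rcases Finset.mem_insert.1 hj with rfl | hj𝓕
      · exact ⟨e, Finset.mem_insert_self e S, heN⟩
      · obtain ⟨a, ha, h⟩ := hNS j hj𝓕
        exact ⟨a, Finset.mem_insert_of_mem ha, h⟩
    · rcases Finset.mem_insert.1 ha with rfl | haS
      · exact ⟨he1X, he2X⟩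
      · exact hSX a haS
    · rcases Finset.mem_insert.1 ha with rfl | haS <;> rcases Finset.mem_insert.1 hb with rfl | hbS
      · exact absurd rfl hab
      · exact ⟨(he1S b hbS).1, (he1S b hbS).2, (he2S b hbS).1, (he2S b hbS).2⟩
      · exact ⟨fun h => (he1S a haS).1 h.symm, fun h => (he2S a haS).1 h.symm,
          fun h => (he1S a haS).2 h.symm, fun h => (he2S a haS).2 h.symm⟩
      · exact hSd a haS b hbS hab

end Summit.ValiantsHypothesis.ValiantsHypothesis.Theorems.DefinabilityGapMatchingClusters
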